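import Summits.AtomisticToContinuum.Crystallization.Theorems.OverbindingBudgetAffineRunCutSheetHop

/-!
# `OverbindingBudget` / crux `RobustDefectLimitWindows` (stmt-AtomisticToContinuum-31280) — «RunCut» part 22B «SHEETACCESS»:
# THE MULTI-HOP PURSUIT ALONG WAYPOINTS (access walks of the pointwise crossing-exclusion engine)

Support file (lens-4 g89; order of record (2c), `ρ₁ = 30`; memo `g89/memo/TWOSHEET-g89.md` §2–§3).  Part 22A `…RunCutSheetHop.sheet_hop` extends an
h-chain by one greedy HOP (≤ `k` basal steps, modes `(k, τ) ∈ {(7, 5.24), (4, 2.87), (3, 2.12)}`) to lateral distance `≤ 0.64 ν_0` of a target.  This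
file ITERATES it along caller-supplied WAYPOINTS `W 0 = y m₀, W 1, …, W 8` (lateral spacing `≤ 23/5 ν_0 = 5.24 − 0.64`, heights `≤ η ν_0` over the
start plane, each waypoint satisfying the REGION inequality of part 22A) and finishes with one SHORT hop (mode `(3, 2.12)`, spacing `≤ 37/25 ν_0`)
to the final target `T` — the short final hop is what keeps the last excursion inside `B(y j, 30 ν_j)` (memo §2: a uniform mode ends at `30.4 ν_j`).

* §1 `lat_add_le` — the lateral part `X ↦ X − ⟪n, X⟫ n` is additive, so lateral norms are subadditive; `chain_guard` — the SHARP metrology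
  of an h-chain `c 0 … c t` (`t ≤ 60`) read from TREE part 20B: unit-axis transport `‖N_t − σ N_0‖ ≤ 26·10⁻⁵ t`, scale window
  `|ν_t − ν_0| ≤ (0.0026 + 3·10⁻⁴ t) ν_0`, height `|⟪N_0, y (c t) − y (c 0)⟫| ≤ (13·10⁻⁵ t² + 25·10⁻⁴ t) ν_0` (part 22A's `sheet_hop_guard` is the
  rounded `t ≤ 59` form; the local endgame of part 22D needs the sharp one on its short chains);
* §2 ★ `multi_hop` — from an h-site `m₀` of the ball, `q ≤ 8` hops of mode `(7, 5.24)` give an h-chain of length `L ≤ 7q` inside the ball, ending at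
  lateral distance `≤ 16/25 ν_0` from `W q` (induction on `q`; `L + 7 ≤ 56 ≤ 60` at every hop start);
* §3 ★★ `access` — `multi_hop 8` followed by one hop of mode `(3, 2.12)` toward `T`: an h-chain of length `L ≤ 59` from `m₀`, inside the ball, basal
  steps, ending at lateral distance `≤ 16/25 ν_0` from `T` (its metrology is then `chain_guard` at `t = L`).  The waypoints are the CALLER's (part 22D
  places them on the segment `[y m₀, T]`).
[this file: 0 definitions, 4 theorems; imports `…RunCutSheetHop` (part 22A) only; standard axioms]
-/

namespace Summit.AtomisticToContinuum.Crystallization.Theorems.OverbindingBudgetAffineRunCutSheetAccess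

open scoped InnerProductSpace
open Literature.Geometry.DiscreteGeometry
open Summit.AtomisticToContinuum.Crystallization.Theorems.OverbindingBudgetAffineRunCutSheetWalk (sheet_walk_record sheet_walk_height sheet_walk_axis_unit)
open Summit.AtomisticToContinuum.Crystallization.Theorems.OverbindingBudgetAffineRunCutSheetHop (chain_charts sheet_hop)

variable {N : ℕ}

local notation "E3" => EuclideanSpace ℝ (Fin 3)

/-! ## §1 Lateral parts are additive -/

/-- `‖lat_n (X + Y)‖ ≤ ‖lat_n X‖ + ‖lat_n Y‖` for the lateral part `lat_n X = X − ⟪n, X⟫ n` (any `n`). [this file · kind: glue] -/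
theorem lat_add_le (n X Y : E3) :
    ‖(X + Y) - ⟪n, X + Y⟫_ℝ • n‖ ≤ ‖X - ⟪n, X⟫_ℝ • n‖ + ‖Y - ⟪n, Y⟫_ℝ • n‖ := by
  have e : (X + Y) - ⟪n, X + Y⟫_ℝ • n = (X - ⟪n, X⟫_ℝ • n) + (Y - ⟪n, Y⟫_ℝ • n) := by
    rw [inner_add_right, add_smul]; abel
  rw [e]; exact norm_add_le _ _

section Atlas

/-! ONE chart datum on the ball `B(y j, ρ₁ ν_j)` (verbatim §2 of part 22A / `…RunCutRebase.charts_of_affDeepReg_radius`). -/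
variable {y : Fin N → E3} (hy : Function.Injective y) {j : Fin N} {ρ₁ : ℝ}
  {Ac : Fin N → (E3 →ₗ[ℝ] E3)} {Qc : Fin N → (E3 →ₗᵢ[ℝ] E3)} {Pc : Fin N → Finset E3} {fc : Fin N → E3 → E3}
  (hP : ∀ i, dist (y i) (y j) ≤ ρ₁ * nearestDist y j → Pc i = fccTwoShellPattern ∨ Pc i = hcpTwoShellPattern)
  (hA : ∀ i, dist (y i) (y j) ≤ ρ₁ * nearestDist y j → ∀ v ∈ Pc i, ‖Ac i v - Qc i v‖ ≤ 1 / 1000)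
  (hf : ∀ i, dist (y i) (y j) ≤ ρ₁ * nearestDist y j → ∀ v ∈ Pc i,
    fc i v ∈ Set.range y ∧ dist (fc i v) (y i + nearestDist y i • Ac i v) ≤ 1 / 10 ^ 4 * nearestDist y i)
  (hinj : ∀ i, dist (y i) (y j) ≤ ρ₁ * nearestDist y j → Set.InjOn (fc i) ↑(Pc i))
  (hex : ∀ i, dist (y i) (y j) ≤ ρ₁ * nearestDist y j → ∀ k : Fin N, k ≠ i →
    dist (y k) (y i) ≤ (3 / 2 + 1 / 450) * nearestDist y i → ∃ v ∈ Pc i, fc i v = y k)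

include hy hA hf hinj hex

/-- **SHARP CHAIN METROLOGY.**  Along an h-chain `c 0, …, c t` of the ball (`t ≤ 60`) with basal steps, `n` the unit axis of the first chart:
the unit axis at `c t` is `σ n` up to `26·10⁻⁵ t` (`σ = ±1`), the scale window is `|ν_t − ν_0| ≤ (0.0026 + 3·10⁻⁴ t) ν_0`, and the height of `y (c t)`
over the plane `(y (c 0), n)` is at most `(13·10⁻⁵ t² + 25·10⁻⁴ t) ν_0` — TREE `…SheetWalk.sheet_walk_axis_unit / _record / _height` read through
`…SheetHop.chain_charts`. [this file · kind: glue] -/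
theorem chain_guard {c : ℕ → Fin N} {u : ℕ → E3} {t : ℕ} (ht : t ≤ 60)
    (hAll : ∀ t', t' ≤ t → dist (y (c t')) (y j) ≤ ρ₁ * nearestDist y j ∧ Pc (c t') = hcpTwoShellPattern)
    (hBll : ∀ t', t' < t → u t' ∈ hcpTwoShellPattern ∧ u t' 0 + u t' 1 + u t' 2 = 0 ∧ fc (c t') (u t') = y (c (t' + 1)))
    {n : E3} (hn : n = (‖Ac (c 0) ((Real.sqrt 18)⁻¹ • intVec ![4, 4, 4])‖⁻¹ • Ac (c 0) ((Real.sqrt 18)⁻¹ • intVec ![4, 4, 4]) : E3)) :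
    (∃ σ : ℝ, (σ = 1 ∨ σ = -1) ∧
      ‖(‖Ac (c t) ((Real.sqrt 18)⁻¹ • intVec ![4, 4, 4])‖⁻¹ • Ac (c t) ((Real.sqrt 18)⁻¹ • intVec ![4, 4, 4]) : E3) - σ • n‖
        ≤ 26 / 100000 * t) ∧
    |nearestDist y (c t) - nearestDist y (c 0)| ≤ (26 / 10000 + 3 / 10000 * t) * nearestDist y (c 0) ∧
    |⟪n, y (c t) - y (c 0)⟫_ℝ| ≤ (13 / 100000 * t ^ 2 + 25 / 10000 * t) * nearestDist y (c 0) := by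
  obtain ⟨hA1, hf1, hinj1, hex1⟩ := chain_charts hA hf hinj hex hAll
  obtain ⟨σ, hσ, hax⟩ := sheet_walk_axis_unit hy c (fun t => Qc (c t)) (fun t => Ac (c t)) (fun t => fc (c t)) u
    (K := t) (by omega) hA1 hf1 hinj1 hex1 hBll t le_rfl
  have hwin := (sheet_walk_record hy c (fun t => Qc (c t)) (fun t => Ac (c t)) (fun t => fc (c t)) u
    (K := t) (by omega) hA1 hf1 hinj1 hex1 hBll t le_rfl).1
  have hht := sheet_walk_height hy c (fun t => Qc (c t)) (fun t => Ac (c t)) (fun t => fc (c t)) u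
    (K := t) (by omega) hA1 hf1 hinj1 hex1 hBll t le_rfl
  rw [← hn] at hax hht
  exact ⟨⟨σ, hσ, hax⟩, hwin, hht⟩

include hP

/-! ## §2 The multi-hop pursuit -/

/-- ★ **MULTI-HOP PURSUIT.**  An h-site `m₀` of the ball, `n` the unit axis of its chart, waypoints `W 0 = y m₀, W 1, …, W 8` with lateral spacing
`‖lat_n (W (i+1) − W i)‖ ≤ (23/5) ν_0`, heights `|⟪n, W i − y m₀⟫| ≤ η ν_0`, `5.24² + (η + 0.61)² ≤ E²` and the REGION inequality
`dist (W i) (y j) + (E + 1.03) ν_0 ≤ ρ₁ ν_j` for every waypoint.  Then for every `q ≤ 8` there is an h-chain `c 0 = m₀, …, c L` (`L ≤ 7 q`) of sites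
of the ball, all h-sites, with basal steps `w`, ending at lateral distance `≤ (16/25) ν_0` from `W q`. [this file · kind: proof] -/
theorem multi_hop {m₀ : Fin N} (hball₀ : dist (y m₀) (y j) ≤ ρ₁ * nearestDist y j) (hP₀ : Pc m₀ = hcpTwoShellPattern)
    {n : E3} (hn : n = (‖Ac m₀ ((Real.sqrt 18)⁻¹ • intVec ![4, 4, 4])‖⁻¹ • Ac m₀ ((Real.sqrt 18)⁻¹ • intVec ![4, 4, 4]) : E3))
    (W : ℕ → E3) (hW0 : W 0 = y m₀) {η E : ℝ}
    (hWlat : ∀ i, i < 8 → ‖(W (i + 1) - W i) - ⟪n, W (i + 1) - W i⟫_ℝ • n‖ ≤ 23 / 5 * nearestDist y m₀)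
    (hWη : ∀ i, i ≤ 8 → |⟪n, W i - y m₀⟫_ℝ| ≤ η * nearestDist y m₀) (hE0 : 0 ≤ E)
    (hE : (131 / 25 : ℝ) ^ 2 + (η + 61 / 100) ^ 2 ≤ E ^ 2)
    (hWreg : ∀ i, i ≤ 8 → dist (W i) (y j) + (E + 103 / 100) * nearestDist y m₀ ≤ ρ₁ * nearestDist y j) :
    ∀ q, q ≤ 8 → ∃ (c : ℕ → Fin N) (w : ℕ → E3) (L : ℕ), L ≤ 7 * q ∧ c 0 = m₀ ∧
      (∀ t, t ≤ L → dist (y (c t)) (y j) ≤ ρ₁ * nearestDist y j ∧ Pc (c t) = hcpTwoShellPattern) ∧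
      (∀ t, t < L → w t ∈ hcpTwoShellPattern ∧ w t 0 + w t 1 + w t 2 = 0 ∧ fc (c t) (w t) = y (c (t + 1))) ∧
      ‖(W q - y (c L)) - ⟪n, W q - y (c L)⟫_ℝ • n‖ ≤ 16 / 25 * nearestDist y m₀ := by
  intro q
  induction q with
  | zero =>
    intro _
    refine ⟨fun _ => m₀, fun _ => 0, 0, le_rfl, rfl, fun t ht => ⟨hball₀, hP₀⟩, fun t ht => absurd ht (Nat.not_lt_zero _), ?_⟩
    rw [hW0, sub_self, inner_zero_right, zero_smul, sub_zero, norm_zero]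
    exact mul_nonneg (by norm_num) (nearestDist_nonneg y m₀)
  | succ q ih =>
    intro hq
    obtain ⟨c, w, L, hL, hc0, hpre, hstep, hlat⟩ := ih (by omega)
    have hn' : n = (‖Ac (c 0) ((Real.sqrt 18)⁻¹ • intVec ![4, 4, 4])‖⁻¹ • Ac (c 0) ((Real.sqrt 18)⁻¹ • intVec ![4, 4, 4]) : E3) := by
      rw [hc0]; exact hn
    have hη' : |⟪n, W (q + 1) - y (c 0)⟫_ℝ| ≤ η * nearestDist y (c 0) := by rw [hc0]; exact hWη (q + 1) hq
    have hreg' : dist (W (q + 1)) (y j) + (E + 103 / 100) * nearestDist y (c 0) ≤ ρ₁ * nearestDist y j := by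
      rw [hc0]; exact hWreg (q + 1) hq
    have hR0 : ‖(W (q + 1) - y (c L)) - ⟪n, W (q + 1) - y (c L)⟫_ℝ • n‖ ≤ 131 / 25 * nearestDist y (c 0) := by
      have e : W (q + 1) - y (c L) = (W (q + 1) - W q) + (W q - y (c L)) := by abel
      rw [e, hc0]
      exact (lat_add_le n _ _).trans (by linarith [hWlat q (by omega), hlat])
    obtain ⟨c', w', s, hs, hc'le, hw'lt, hpre', hstep', hlat'⟩ :=
      sheet_hop hy hP hA hf hinj hex (k := 7) (τ := 131 / 25) (Or.inl ⟨rfl, rfl⟩) (by omega) hpre hstep hn' (W (q + 1)) hη' hE0 hE hreg' hR0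
    refine ⟨c', w', L + s, by omega, by rw [hc'le 0 (Nat.zero_le _), hc0], hpre', hstep', ?_⟩
    rw [hc0] at hlat'
    exact hlat'

/-! ## §3 The access walk -/

/-- ★★ **ACCESS WALK.**  The data of `multi_hop` plus a final target `T` at lateral distance `≤ (37/25) ν_0` from `W 8`, height `≤ η' ν_0` over the
start plane, `2.12² + (η' + 0.61)² ≤ E'²` and `dist T (y j) + (E' + 1.03) ν_0 ≤ ρ₁ ν_j`.  Then there is an h-chain `c 0 = m₀, …, c L` with `L ≤ 59`,
all sites in the ball and h-sites, basal steps, ending at lateral distance `≤ (16/25) ν_0` from `T` (the short final hop keeps the last excursion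
inside the ball, memo §2; the end site's window / axis / height are `chain_guard` at `t = L`). [this file · kind: proof] -/
theorem access {m₀ : Fin N} (hball₀ : dist (y m₀) (y j) ≤ ρ₁ * nearestDist y j) (hP₀ : Pc m₀ = hcpTwoShellPattern)
    {n : E3} (hn : n = (‖Ac m₀ ((Real.sqrt 18)⁻¹ • intVec ![4, 4, 4])‖⁻¹ • Ac m₀ ((Real.sqrt 18)⁻¹ • intVec ![4, 4, 4]) : E3))
    (W : ℕ → E3) (hW0 : W 0 = y m₀) {η E : ℝ}
    (hWlat : ∀ i, i < 8 → ‖(W (i + 1) - W i) - ⟪n, W (i + 1) - W i⟫_ℝ • n‖ ≤ 23 / 5 * nearestDist y m₀)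
    (hWη : ∀ i, i ≤ 8 → |⟪n, W i - y m₀⟫_ℝ| ≤ η * nearestDist y m₀) (hE0 : 0 ≤ E)
    (hE : (131 / 25 : ℝ) ^ 2 + (η + 61 / 100) ^ 2 ≤ E ^ 2)
    (hWreg : ∀ i, i ≤ 8 → dist (W i) (y j) + (E + 103 / 100) * nearestDist y m₀ ≤ ρ₁ * nearestDist y j)
    (T : E3) {η' E' : ℝ} (hTlat : ‖(T - W 8) - ⟪n, T - W 8⟫_ℝ • n‖ ≤ 37 / 25 * nearestDist y m₀)
    (hTη : |⟪n, T - y m₀⟫_ℝ| ≤ η' * nearestDist y m₀) (hE0' : 0 ≤ E') (hE' : (53 / 25 : ℝ) ^ 2 + (η' + 61 / 100) ^ 2 ≤ E' ^ 2)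
    (hTreg : dist T (y j) + (E' + 103 / 100) * nearestDist y m₀ ≤ ρ₁ * nearestDist y j) :
    ∃ (c : ℕ → Fin N) (w : ℕ → E3) (L : ℕ), L ≤ 59 ∧ c 0 = m₀ ∧
      (∀ t, t ≤ L → dist (y (c t)) (y j) ≤ ρ₁ * nearestDist y j ∧ Pc (c t) = hcpTwoShellPattern) ∧
      (∀ t, t < L → w t ∈ hcpTwoShellPattern ∧ w t 0 + w t 1 + w t 2 = 0 ∧ fc (c t) (w t) = y (c (t + 1))) ∧
      ‖(T - y (c L)) - ⟪n, T - y (c L)⟫_ℝ • n‖ ≤ 16 / 25 * nearestDist y m₀ := by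
  obtain ⟨c, w, L, hL, hc0, hpre, hstep, hlat⟩ :=
    multi_hop hy hP hA hf hinj hex hball₀ hP₀ hn W hW0 hWlat hWη hE0 hE hWreg 8 le_rfl
  have hn' : n = (‖Ac (c 0) ((Real.sqrt 18)⁻¹ • intVec ![4, 4, 4])‖⁻¹ • Ac (c 0) ((Real.sqrt 18)⁻¹ • intVec ![4, 4, 4]) : E3) := by
    rw [hc0]; exact hn
  have hη' : |⟪n, T - y (c 0)⟫_ℝ| ≤ η' * nearestDist y (c 0) := by rw [hc0]; exact hTη
  have hreg' : dist T (y j) + (E' + 103 / 100) * nearestDist y (c 0) ≤ ρ₁ * nearestDist y j := by rw [hc0]; exact hTreg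
  have hR0 : ‖(T - y (c L)) - ⟪n, T - y (c L)⟫_ℝ • n‖ ≤ 53 / 25 * nearestDist y (c 0) := by
    have e : T - y (c L) = (T - W 8) + (W 8 - y (c L)) := by abel
    rw [e, hc0]
    exact (lat_add_le n _ _).trans (by linarith [hTlat, hlat])
  obtain ⟨c', w', s, hs, hc'le, hw'lt, hpre', hstep', hlat'⟩ :=
    sheet_hop hy hP hA hf hinj hex (k := 3) (τ := 53 / 25) (Or.inr (Or.inr ⟨rfl, rfl⟩)) (by omega) hpre hstep hn' T hη' hE0' hE' hreg' hR0
  rw [hc0] at hlat'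
  exact ⟨c', w', L + s, by omega, by rw [hc'le 0 (Nat.zero_le _), hc0], hpre', hstep', hlat'⟩

end Atlas

end Summit.AtomisticToContinuum.Crystallization.Theorems.OverbindingBudgetAffineRunCutSheetAccess
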